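import Summits.AtomisticToContinuum.Crystallization.Theorems.FrustratedLawDichotomyStrainedPatchHomLeafTableRow

/-!
# v2 leaf checker — the FOLD INVARIANT (integer layer of the soundness proof)

decomp-a2c hand-1 g20 (crux `AperiodicFrustratedLawGap`, stmt-AtomisticToContinuum-27623; critic row 806 (2)(C)).  For the ℕ-encoded fold
`foldNL` of `…HomLeafTableCheck`: (i) failure is absorbing (`ok = false` propagates), hence a passing leaf has every visited label either FAR-skipped
or TREATED with a table row covering its range; (ii) the accumulator of a passing fold is the fieldwise SUM of per-label increments `incr` (the label's
`step4` applied to the empty accumulator); (iii) the visited labels are the prefix before the stop norm.  Small proof-side definitions (`Acc.add`,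
`stepOK`, `treated`, `incr`, `visited`); no analysis here.  0 sorry; standard axioms.  `--supports stmt-AtomisticToContinuum-27623`.
-/

namespace Summit.AtomisticToContinuum.Crystallization.Theorems.FrustratedLawDichotomyStrainedPatchHomLeafTableCheck

/-! ## §1. Proof-side bookkeeping definitions -/

/-- Fieldwise sum of accumulators (`ok` conjoined). -/
def Acc.add (a c : Acc) : Acc :=
  ⟨a.ok && c.ok, a.vP + c.vP, a.vN + c.vN, a.dP + c.dP, a.dN + c.dN, a.sd + c.sd, a.g0P + c.g0P, a.g0N + c.g0N, a.g1P + c.g1P, a.g1N + c.g1N,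
   a.g2P + c.g2P, a.g2N + c.g2N, a.g3P + c.g3P, a.g3N + c.g3N, a.g4P + c.g4P, a.g4N + c.g4N, a.g5P + c.g5P, a.g5N + c.g5N, a.cur + c.cur⟩

/-- The label's scaled centre value `q0 = qPos − qNeg` (meaningful when `qNeg ≤ qPos`). -/
def q0N (k : LK) (l : NL) : ℕ := qPos k l - qNeg k l

/-- The label is FAR for this box: `81·SC ≤ 4·(q0 − r)`. -/
def farB (k : LK) (l : NL) : Bool := Nat.ble (Nat.mul 81 SCN) (Nat.mul 4 (q0N k l - rad k l))

/-- The row found for the label. -/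
def rowOf (tab : QT) (k : LK) (l : NL) : Option Row := QT.findLE (q0N k l) tab none

/-- The range test of `step3` for a row. -/
def rangeB (k : LK) (l : NL) (row : Row) : Bool :=
  Nat.ble row.A (q0N k l - rad k l) && Nat.ble (q0N k l + rad k l) row.B && Nat.ble row.t (q0N k l)

/-- The label passes the step without failure. -/
def stepOK (tab : QT) (k : LK) (l : NL) : Bool :=
  Nat.ble (qNeg k l + rad k l) (qPos k l) &&
    (farB k l || match rowOf tab k l with | none => false | some row => rangeB k l row)

/-- The label is TREATED (not far, row found and in range). -/
def treated (tab : QT) (k : LK) (l : NL) : Bool :=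
  Nat.ble (qNeg k l + rad k l) (qPos k l) && !farB k l &&
    (match rowOf tab k l with | none => false | some row => rangeB k l row)

/-- The label's increment: its `step4` on the empty accumulator (zero if not treated). -/
def incr (tab : QT) (k : LK) (l : NL) : Acc :=
  match treated tab k l, rowOf tab k l with
  | true, some row => step4 acc0 l (rad k l) row (q0N k l - row.t)
  | _, _ => acc0

/-- The visited prefix: records before the first one with `n ≥ nstop`. -/
def visited (nstop : ℕ) : List NL → List NL
  | [] => []
  | l :: ls => match Nat.ble nstop l.n with
    | true => []
    | false => l :: visited nstop ls

/-! ## §2. Elementary facts about the step -/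

/-- `addP s x p = p + addP s x 0`. [formal bookkeeping] -/
theorem addP_eq (s : Bool) (x p : ℕ) : addP s x p = p + addP s x 0 := by cases s <;> simp [addP]

/-- `addN s x n = n + addN s x 0`. [formal bookkeeping] -/
theorem addN_eq (s : Bool) (x n : ℕ) : addN s x n = n + addN s x 0 := by cases s <;> simp [addN]

/-- `step4` is additive: it adds the label's increment to the accumulator. [formal bookkeeping] -/
theorem step4_eq_add (a : Acc) (l : NL) (r : ℕ) (row : Row) (δ : ℕ) : step4 a l r row δ = a.add (step4 acc0 l r row δ) := by
  cases a
  simp only [step4, Acc.add, acc0, Bool.and_true]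
  congr 1 <;> first | rfl | (rw [addP_eq]) | (rw [addN_eq]) | simp [Nat.add_eq]

/-- Unfolding of the step into the proof-side predicates. [formal bookkeeping] -/
theorem step_unfold (tab : QT) (k : LK) (a : Acc) (l : NL) :
    step tab k a l =
      (match Nat.ble (qNeg k l + rad k l) (qPos k l) with
        | true => (match farB k l with
          | true => a
          | false => (match rowOf tab k l with
            | none => a.fail
            | some row => (match rangeB k l row with
              | true => step4 a l (rad k l) row (q0N k l - row.t)
              | false => a.fail)))
        | false => a.fail) := by
  rfl

/-- A treated label adds its increment. [formal bookkeeping] -/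
theorem step_of_treated {tab : QT} {k : LK} {l : NL} (h : treated tab k l = true) (a : Acc) : step tab k a l = a.add (incr tab k l) := by
  rw [step_unfold]
  unfold incr
  rw [h]
  unfold treated at h
  cases h1 : Nat.ble (qNeg k l + rad k l) (qPos k l)
  · rw [h1] at h; simp at h
  · rw [h1] at h
    cases h2 : farB k l
    · rw [h2] at h
      cases h3 : rowOf tab k l with
      | none => rw [h3] at h; simp at h
      | some row =>
        rw [h3] at h
        simp only [Bool.true_and, Bool.not_false] at h
        simp only [h]
        exact step4_eq_add a l (rad k l) row _
    · rw [h2] at h; simp at h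

/-- A passing, untreated label is far-skipped: the accumulator is unchanged. [formal bookkeeping] -/
theorem step_of_far {tab : QT} {k : LK} {l : NL} (hs : stepOK tab k l = true) (ht : treated tab k l = false) (a : Acc) : step tab k a l = a := by
  rw [step_unfold]
  unfold stepOK at hs
  unfold treated at ht
  cases h1 : Nat.ble (qNeg k l + rad k l) (qPos k l)
  · rw [h1] at hs; simp at hs
  · rw [h1] at hs ht
    cases h2 : farB k l
    · rw [h2] at hs ht
      simp only [Bool.true_and, Bool.false_or, Bool.not_false] at hs ht
      cases h3 : rowOf tab k l with
      | none => rw [h3] at hs; simp at hs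
      | some row => rw [h3] at hs ht; simp only at hs ht; rw [hs] at ht; simp at ht
    · rfl

/-- A failing label sets `ok := false`. [formal bookkeeping] -/
theorem ok_step_of_not_stepOK {tab : QT} {k : LK} {l : NL} (hs : stepOK tab k l = false) (a : Acc) : (step tab k a l).ok = false := by
  rw [step_unfold]
  unfold stepOK at hs
  cases h1 : Nat.ble (qNeg k l + rad k l) (qPos k l)
  · rfl
  · rw [h1] at hs
    cases h2 : farB k l
    · rw [h2] at hs
      simp only [Bool.true_and, Bool.false_or] at hs
      cases h3 : rowOf tab k l with
      | none => rfl
      | some row =>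
        rw [h3] at hs; simp only at hs
        simp only [hs]
        rfl
    · rw [h2] at hs; simp at hs

/-- Failure is absorbing for one step. [formal bookkeeping] -/
theorem ok_step_of_fail {tab : QT} {k : LK} {a : Acc} {l : NL} (h : a.ok = false) : (step tab k a l).ok = false := by
  cases hs : stepOK tab k l
  · exact ok_step_of_not_stepOK hs a
  · cases ht : treated tab k l
    · rw [step_of_far hs ht]; exact h
    · rw [step_of_treated ht]; simp [Acc.add, h]

/-! ## §3. The fold -/

/-- `foldNL` is the left fold of `step` over the visited prefix. [formal bookkeeping] -/
theorem foldNL_eq (tab : QT) (k : LK) (nstop : ℕ) : ∀ (ls : List NL) (a : Acc),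
    foldNL tab k nstop a ls = (visited nstop ls).foldl (step tab k) a
  | [], a => rfl
  | l :: ls, a => by
    unfold foldNL visited
    cases Nat.ble nstop l.n
    · simp only [List.foldl_cons]; exact foldNL_eq tab k nstop ls _
    · rfl

/-- Failure is absorbing for the fold. [formal bookkeeping] -/
theorem ok_foldl_of_fail (tab : QT) (k : LK) : ∀ (ls : List NL) (a : Acc), a.ok = false → (ls.foldl (step tab k) a).ok = false
  | [], _, h => h
  | _ :: ls, _, h => ok_foldl_of_fail tab k ls _ (ok_step_of_fail h)

/-- ★ **THE FOLD INVARIANT.**  If the fold passes (`ok = true` at the end) then it started with `ok = true`, every label of the list passes its step, and the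
final accumulator is the start plus the increments of the treated labels, added in order. [formal bookkeeping] -/
theorem foldl_step_eq (tab : QT) (k : LK) : ∀ (ls : List NL) (a : Acc), (ls.foldl (step tab k) a).ok = true →
    a.ok = true ∧ (∀ l ∈ ls, stepOK tab k l = true) ∧
      ls.foldl (step tab k) a = (ls.filter (fun l => treated tab k l)).foldl (fun acc l => acc.add (incr tab k l)) a
  | [], a, h => ⟨h, fun _ hl => (List.not_mem_nil hl).elim, rfl⟩
  | l :: ls, a, h => by
    rw [List.foldl_cons] at h
    cases hs : stepOK tab k l
    · have := ok_foldl_of_fail tab k ls _ (ok_step_of_not_stepOK hs a)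
      rw [h] at this; exact Bool.noConfusion this
    · obtain ⟨hok, hall, heq⟩ := foldl_step_eq tab k ls _ h
      refine ⟨?_, ?_, ?_⟩
      · cases ht : treated tab k l
        · rwa [step_of_far hs ht] at hok
        · rw [step_of_treated ht] at hok
          simp only [Acc.add, Bool.and_eq_true] at hok
          exact hok.1
      · intro l' hl'
        rcases List.mem_cons.1 hl' with rfl | hmem
        · exact hs
        · exact hall l' hmem
      · rw [List.foldl_cons, List.filter_cons]
        cases ht : treated tab k l
        · simp only [Bool.false_eq_true, ite_false]
          rw [step_of_far hs ht] at heq ⊢; exact heq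
        · simp only [ite_true, List.foldl_cons]
          rw [step_of_treated ht] at heq ⊢; exact heq

/-- Projections that are additive under `Acc.add` sum along the increment fold. [formal bookkeeping] -/
theorem proj_foldl_add (π : Acc → ℕ) (hπ : ∀ a c, π (a.add c) = π a + π c) (f : NL → Acc) :
    ∀ (ls : List NL) (a : Acc), π (ls.foldl (fun acc l => acc.add (f l)) a) = π a + (ls.map (fun l => π (f l))).sum
  | [], a => by simp
  | l :: ls, a => by rw [List.foldl_cons, proj_foldl_add π hπ f ls, hπ, List.map_cons, List.sum_cons, Nat.add_assoc]

/-- The visited prefix is a sublist-prefix of the list: its members are members. [formal bookkeeping] -/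
theorem mem_of_mem_visited (nstop : ℕ) : ∀ (ls : List NL) (l : NL), l ∈ visited nstop ls → l ∈ ls
  | [], l, h => h
  | l' :: ls, l, h => by
    unfold visited at h
    cases hb : Nat.ble nstop l'.n
    · rw [hb] at h
      rcases List.mem_cons.1 h with rfl | h'
      · exact List.mem_cons_self
      · exact List.mem_cons_of_mem _ (mem_of_mem_visited nstop ls l h')
    · rw [hb] at h; cases h

/-- Visited labels are below the stop norm. [formal bookkeeping] -/
theorem lt_of_mem_visited (nstop : ℕ) : ∀ (ls : List NL) (l : NL), l ∈ visited nstop ls → l.n < nstop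
  | [], l, h => by cases h
  | l' :: ls, l, h => by
    unfold visited at h
    cases hb : Nat.ble nstop l'.n
    · rw [hb] at h
      rcases List.mem_cons.1 h with rfl | h'
      · exact Nat.lt_of_not_le fun hle => by rw [Nat.ble_eq_true_of_le hle] at hb; exact Bool.noConfusion hb
      · exact lt_of_mem_visited nstop ls l h'
    · rw [hb] at h; cases h

/-- In a list SORTED by `n` (non-decreasing), a label not visited has `n ≥ nstop`. [formal bookkeeping] -/
theorem le_of_not_mem_visited (nstop : ℕ) : ∀ (ls : List NL), ls.Pairwise (fun x y => x.n ≤ y.n) →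
    ∀ l ∈ ls, l ∉ visited nstop ls → nstop ≤ l.n
  | [], _, l, h, _ => by cases h
  | l' :: ls, hs, l, h, hv => by
    rw [List.pairwise_cons] at hs
    unfold visited at hv
    cases hb : Nat.ble nstop l'.n
    · rw [hb] at hv
      rcases List.mem_cons.1 h with rfl | h'
      · exact absurd List.mem_cons_self hv
      · exact le_of_not_mem_visited nstop ls hs.2 l h' (fun hm => hv (List.mem_cons_of_mem _ hm))
    · have hle : nstop ≤ l'.n := Nat.le_of_ble_eq_true hb
      rcases List.mem_cons.1 h with rfl | h'
      · exact hle
      · exact hle.trans (hs.1 l h')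

end Summit.AtomisticToContinuum.Crystallization.Theorems.FrustratedLawDichotomyStrainedPatchHomLeafTableCheck
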